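import Summits.HubbardSuperconductivity.HubbardSuperconductivity.Theorems.KLProgrammeKLRegimeScaleZeroCovarianceOffSiteDoor

/-!
# Route `KLProgramme`, crux K3 — engine-flow child (stmt-HubbardSuperconductivity-20437), stub (C) at `n = 0`, located item #22a «(C)-SCALE0-PT2»,
# §2c PROFILE BRIDGE: a certified pointwise majorant `p ≥ |ǧ|` of the `β = ∞` kernel turns the off-site door into the `ℝ≥0∞` image-sum majorant
# `Σ_m p(τ* + mβ)` of `…ScaleZeroBetaWindowReduction` (D5/D6), plus the two explicit tails

Cell gate-hubbard-kl, seat p1 g20.  D5/D6 (p1 g19) read the β-layer certificate as majorants `Σ'_{m∈ℤ} p(τ + mβ)` of profiles `p : ℝ → ℝ≥0∞`; the door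
(`…OffSiteDoor`) gives the off-site entry as the alternating image sum of `ǧ(t) = (1/2π)𝓕G(t/2π)` up to two tails.  This file is the one-line bridge:

* §1 (generic) **`enorm_tsum_alternating_le_tsum_profile`** — if `Σ_m 𝓕G((mβ+τ)/2π)` is summable and `p(t) ≥ ‖(1/2π)𝓕G(t/2π)‖₊` for all `t`, then
  `‖(1/2π)Σ'_m (−1)^m 𝓕G((mβ+τ)/2π)‖₊ ≤ Σ'_m p(τ + mβ)` in `ℝ≥0∞`; `enorm_le_tsum_profile_add_of_norm_sub_le` — and `‖A‖₊ ≤ Σ'_m p(τ+mβ) + ofReal T` whenever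
  `‖A ∓ images‖ ≤ T`;
* §2 (the door, bare frame, table-free) **`enorm_gridCov_offSite_le_tsum_profile_of_nonpos`** / **`…_of_nonneg`**: for grid points with `x₁ ≠ x₀` and any
  `p : ℝ → ℝ≥0∞` with `p(t) ≥ ‖(1/2π)𝓕G(t/2π)‖₊` (`G = a¹_·(−z)`, `K = 0`, `Λ = klE0`),
  `‖A((p₁,σ,+),(p₀,σ,−))‖₊ ≤ Σ'_m p(τ* + mβ) + ofReal((19/3)(4+|μ|+‖0‖₀)β/(2π²M) + D₀(N′)(2/klE0)(2/(2R+2))^{N′−4}4C₂/(2π)^{N′})`, `τ* = −Δτ` resp. `β − Δτ`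
  — the currency of `sunsetShape_le_of_window` / `sunsetShape_le_of_octaveTable`;
* §3 (appended) `tsum_profile_add_period` (`Σ'_m p(β+s+mβ) = Σ'_m p(s+mβ)`) and **`enorm_gridCov_offSite_le_tsum_profile`** — EITHER sign of `Δτ`:
  `‖A‖₊ ≤ Σ'_m p(−Δτ + mβ) + ofReal(two tails)`; the image-sum majorant is `β`-periodic, so the antiperiodic sign and the case split disappear under the norm;
* §4 (appended) **`enorm_gridCov_offSite_le_tsum_profile_of_proj_eq`** — the same with ANY representative `z` of `x₁ − x₀` (the record's CENTRED
  difference), so the torus-tail condition `R + 1 + Σ|z_j| ≤ L` is usable with `R ≈ L/2`.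

Proofs only; no definitions; nothing here asserts (C), any stub of 20437, K3 or superconductivity.  References: BGM 2006 §2.1 (2.3)–(2.4)
[cite: BenfattoGiulianiMastropietro2006]; Fetter–Walecka 1971 Ch. 7 §25 [cite: FetterWalecka1971].
-/

noncomputable section

namespace Summit.HubbardSuperconductivity.HubbardSuperconductivity.Theorems.KLRegimeSplit

set_option linter.dupNamespace false -- summit = problem name (single-conjunct summit), D-0017

open Literature.MathematicalPhysics.QuantumLattice Literature.Probability.LatticeModels Literature.Analysis.FunctionSpaces
open Summit.HubbardSuperconductivity.HubbardSuperconductivity.Theorems.DispersionFlow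
open MeasureTheory Set Finset Complex UnitAddTorus Real
open scoped FourierTransform Nat ENNReal NNReal

/-! ## §1 Generic: alternating image sums under a pointwise `ℝ≥0∞` majorant -/

/-- **Alternating image sum under a profile**: if `m ↦ 𝓕G((mβ+τ)/2π)` is summable and `‖(1/2π)𝓕G(t/2π)‖₊ ≤ p(t)` for all `t`, then
`‖(1/2π)Σ'_m (−1)^m 𝓕G((mβ+τ)/2π)‖₊ ≤ Σ'_m p(τ + mβ)` (in `ℝ≥0∞`). -/
theorem enorm_tsum_alternating_le_tsum_profile {F : ℝ → ℂ} {β τ : ℝ} (hsum : Summable fun m : ℤ => F ((m * β + τ) / (2 * π)))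
    {p : ℝ → ℝ≥0∞} (hp : ∀ t : ℝ, (‖((1 / (2 * π) : ℝ) : ℂ) * F (t / (2 * π))‖₊ : ℝ≥0∞) ≤ p t) :
    (‖((1 / (2 * π) : ℝ) : ℂ) * ∑' m : ℤ, (-1 : ℂ) ^ m * F ((m * β + τ) / (2 * π))‖₊ : ℝ≥0∞) ≤ ∑' m : ℤ, p (τ + m * β) := by
  set u : ℤ → ℂ := fun m => ((1 / (2 * π) : ℝ) : ℂ) * ((-1 : ℂ) ^ m * F ((m * β + τ) / (2 * π))) with hu
  have hus : Summable fun m => ‖u m‖₊ := by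
    have h1 : Summable fun m : ℤ => ‖F ((m * β + τ) / (2 * π))‖ := hsum.norm
    have h2 : Summable fun m : ℤ => ‖u m‖ := by
      refine (h1.mul_left ‖((1 / (2 * π) : ℝ) : ℂ)‖).congr fun m => ?_
      rw [hu]; simp only [norm_mul, norm_zpow, norm_neg, norm_one, one_zpow, one_mul]
    exact h2.toNNReal.congr fun m => by simp [Real.toNNReal_of_nonneg (norm_nonneg _), ← NNReal.coe_inj]
  rw [← tsum_mul_left]
  calc (‖∑' m : ℤ, u m‖₊ : ℝ≥0∞) ≤ ((∑' m : ℤ, ‖u m‖₊ : ℝ≥0) : ℝ≥0∞) := ENNReal.coe_le_coe.2 (nnnorm_tsum_le hus)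
    _ = ∑' m : ℤ, (‖u m‖₊ : ℝ≥0∞) := ENNReal.coe_tsum hus
    _ ≤ ∑' m : ℤ, p (τ + m * β) := ENNReal.tsum_le_tsum fun m => by
        have h := hp (m * β + τ)
        have hnorm : ‖u m‖₊ = ‖((1 / (2 * π) : ℝ) : ℂ) * F ((m * β + τ) / (2 * π))‖₊ := by
          rw [hu]; simp only [nnnorm_mul, nnnorm_zpow, nnnorm_neg, nnnorm_one, one_zpow, one_mul]
        rw [hnorm, add_comm τ]
        exact h

/-- From `‖A − I‖ ≤ T` (or `‖A − (−I)‖ ≤ T`) and `‖I‖₊ ≤ P`: `‖A‖₊ ≤ P + ofReal T` in `ℝ≥0∞`. -/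
theorem enorm_le_add_ofReal_of_norm_sub_le {A I : ℂ} {T : ℝ} {P : ℝ≥0∞} (hT : ‖A - I‖ ≤ T ∨ ‖A - -I‖ ≤ T) (hI : (‖I‖₊ : ℝ≥0∞) ≤ P) :
    (‖A‖₊ : ℝ≥0∞) ≤ P + ENNReal.ofReal T := by
  have hAle : ‖A‖ ≤ ‖I‖ + T := by
    rcases hT with h | h
    · calc ‖A‖ = ‖I + (A - I)‖ := by ring_nf
        _ ≤ ‖I‖ + ‖A - I‖ := norm_add_le _ _
        _ ≤ ‖I‖ + T := by linarith
    · calc ‖A‖ = ‖-I + (A - -I)‖ := by ring_nf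
        _ ≤ ‖-I‖ + ‖A - -I‖ := norm_add_le _ _
        _ ≤ ‖I‖ + T := by rw [norm_neg]; linarith
  have hT0 : 0 ≤ T := by rcases hT with h | h <;> exact (norm_nonneg _).trans h
  calc (‖A‖₊ : ℝ≥0∞) = ENNReal.ofReal ‖A‖ := by rw [← enorm_eq_nnnorm, ofReal_norm]
    _ ≤ ENNReal.ofReal (‖I‖ + T) := ENNReal.ofReal_le_ofReal hAle
    _ = ENNReal.ofReal ‖I‖ + ENNReal.ofReal T := ENNReal.ofReal_add (norm_nonneg _) hT0
    _ ≤ P + ENNReal.ofReal T := by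
        rw [ofReal_norm, enorm_eq_nnnorm]
        gcongr

/-! ## §2 The door under a certified profile (bare frame, table-free) -/

/-- **Off-site entry under a certified profile, `Δτ ≤ 0`**: for grid points with `x₁ ≠ x₀`, `Δτ = j₁β/N − j₀β/N ≤ 0`, `0 < β`, `1 ≤ M`, `N′ ≥ 4`,
`L ≥ R + 1 + Σ_j|z_j|`, and ANY `p : ℝ → ℝ≥0∞` with `p(t) ≥ ‖(1/2π)𝓕G(t/2π)‖₊` for all `t` (`G = a¹_·(−z)` at `K = 0`, `Λ = klE0`):
`‖A((p₁,σ,+),(p₀,σ,−))‖₊ ≤ Σ'_m p(−Δτ + mβ) + ofReal(window tail + torus tail)`. -/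
theorem enorm_gridCov_offSite_le_tsum_profile_of_nonpos {L M : ℕ} [NeZero L] {β : ℝ} (hβ : 0 < β) (hM : 0 < M) (μ : ℝ) {N : ℕ}
    {p₁ p₀ : GridPoint L N} (hx : p₁.2 ≠ p₀.2) (hΔ : gridTime β N p₁.1 - gridTime β N p₀.1 ≤ 0) (σ : Fin 2) {N' : ℕ} (hN' : 2 * 2 ≤ N')
    {R : ℕ} (hR : (R : ℤ) + 1 + ∑ j, |((p₁.2 j).val : ℤ) - (p₀.2 j).val| ≤ L) {p : ℝ → ℝ≥0∞}
    (hp : ∀ t : ℝ, (‖((1 / (2 * π) : ℝ) : ℂ) * 𝓕 (fun om : ℝ => mFourierCoeff (Torus.descend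
        (fun y : Momentum => uvSymbolFn 1 klE0 (frameLevel μ 0 ((2 * π) • y)) om) (uvSpatialSymbol_isLatticePeriodic 1 klE0 μ 0 om))
        (-(fun j => ((p₁.2 j).val : ℤ) - (p₀.2 j).val))) (t / (2 * π))‖₊ : ℝ≥0∞) ≤ p t) :
    (‖((hubbardGridSub L M β N).transpose * hubbardCovAboveCT L M β μ 0 0 klE0 * hubbardGridSub L M β N) ((p₁, σ), 0) ((p₀, σ), 1)‖₊ : ℝ≥0∞) ≤
      (∑' m : ℤ, p (-(gridTime β N p₁.1 - gridTime β N p₀.1) + m * β)) +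
        ENNReal.ofReal ((19 / 3) * (4 + |μ| + (0 : TrigPolyC4v).coeffNorm 0) * β / (2 * π ^ 2 * M) +
          (N' ! * klChi2CauchyTab N' * (N' + 1) ! * 4 * (max 1 (4 / klE0)) ^ (N' - 1) * ((2 * π) * 4) ^ N') * (2 / klE0) *
            (1 / (2 * Real.pi) ^ N' * (2 / ((2 * R + 2 : ℕ) : ℝ)) ^ (N' - 2 * 2) * (2 ^ 2 * ∑' k : Site 2, ∏ j, (1 + (k j : ℝ) ^ 2)⁻¹))) := by
  have hE0 : (0 : ℝ) < klE0 := by norm_num [klE0]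
  have hz' : -(fun j => ((p₁.2 j).val : ℤ) - (p₀.2 j).val) ≠ 0 := neg_ne_zero.2 (valSub_ne_zero hx)
  obtain ⟨hlo, -⟩ := gridTime_sub_mem hβ.le p₁.1 p₀.1
  have hsum := latticeKernel_images_summable zero_le_one hE0 μ 0 (one_le_klChi2CauchyTab 2) (salmhoferCutoff_flat_cauchy_table_deriv 2)
    (fun q => Summit.HubbardSuperconductivity.HubbardSuperconductivity.Theorems.EngineV8.norm_iteratedFDeriv_frameLevel_zero_le μ le_rfl q) hz' hβ
    (τ := -(gridTime β N p₁.1 - gridTime β N p₀.1)) (by linarith) (by linarith)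
  exact enorm_le_add_ofReal_of_norm_sub_le (Or.inl (norm_gridCov_offSite_sub_images_le_of_nonpos hβ hM μ hx hΔ σ hN' hR))
    (enorm_tsum_alternating_le_tsum_profile hsum hp)

/-- **Off-site entry under a certified profile, `Δτ ≥ 0`**: as above with `0 ≤ Δτ`, the profile read at `τ* = β − Δτ`:
`‖A((p₁,σ,+),(p₀,σ,−))‖₊ ≤ Σ'_m p((β − Δτ) + mβ) + ofReal(window tail + torus tail)`. -/
theorem enorm_gridCov_offSite_le_tsum_profile_of_nonneg {L M : ℕ} [NeZero L] {β : ℝ} (hβ : 0 < β) (hM : 0 < M) (μ : ℝ) {N : ℕ}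
    {p₁ p₀ : GridPoint L N} (hx : p₁.2 ≠ p₀.2) (hΔ : 0 ≤ gridTime β N p₁.1 - gridTime β N p₀.1) (σ : Fin 2) {N' : ℕ} (hN' : 2 * 2 ≤ N')
    {R : ℕ} (hR : (R : ℤ) + 1 + ∑ j, |((p₁.2 j).val : ℤ) - (p₀.2 j).val| ≤ L) {p : ℝ → ℝ≥0∞}
    (hp : ∀ t : ℝ, (‖((1 / (2 * π) : ℝ) : ℂ) * 𝓕 (fun om : ℝ => mFourierCoeff (Torus.descend
        (fun y : Momentum => uvSymbolFn 1 klE0 (frameLevel μ 0 ((2 * π) • y)) om) (uvSpatialSymbol_isLatticePeriodic 1 klE0 μ 0 om))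
        (-(fun j => ((p₁.2 j).val : ℤ) - (p₀.2 j).val))) (t / (2 * π))‖₊ : ℝ≥0∞) ≤ p t) :
    (‖((hubbardGridSub L M β N).transpose * hubbardCovAboveCT L M β μ 0 0 klE0 * hubbardGridSub L M β N) ((p₁, σ), 0) ((p₀, σ), 1)‖₊ : ℝ≥0∞) ≤
      (∑' m : ℤ, p ((β - (gridTime β N p₁.1 - gridTime β N p₀.1)) + m * β)) +
        ENNReal.ofReal ((19 / 3) * (4 + |μ| + (0 : TrigPolyC4v).coeffNorm 0) * β / (2 * π ^ 2 * M) +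
          (N' ! * klChi2CauchyTab N' * (N' + 1) ! * 4 * (max 1 (4 / klE0)) ^ (N' - 1) * ((2 * π) * 4) ^ N') * (2 / klE0) *
            (1 / (2 * Real.pi) ^ N' * (2 / ((2 * R + 2 : ℕ) : ℝ)) ^ (N' - 2 * 2) * (2 ^ 2 * ∑' k : Site 2, ∏ j, (1 + (k j : ℝ) ^ 2)⁻¹))) := by
  have hE0 : (0 : ℝ) < klE0 := by norm_num [klE0]
  have hz' : -(fun j => ((p₁.2 j).val : ℤ) - (p₀.2 j).val) ≠ 0 := neg_ne_zero.2 (valSub_ne_zero hx)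
  obtain ⟨-, hhi⟩ := gridTime_sub_mem hβ.le p₁.1 p₀.1
  have hsum := latticeKernel_images_summable zero_le_one hE0 μ 0 (one_le_klChi2CauchyTab 2) (salmhoferCutoff_flat_cauchy_table_deriv 2)
    (fun q => Summit.HubbardSuperconductivity.HubbardSuperconductivity.Theorems.EngineV8.norm_iteratedFDeriv_frameLevel_zero_le μ le_rfl q) hz' hβ
    (τ := β - (gridTime β N p₁.1 - gridTime β N p₀.1)) (by linarith) (by linarith)
  exact enorm_le_add_ofReal_of_norm_sub_le (Or.inr (norm_gridCov_offSite_sub_neg_images_le_of_nonneg hβ hM μ hx hΔ σ hN' hR))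
    (enorm_tsum_alternating_le_tsum_profile hsum hp)

/-! ## §3 One profile reading for both signs of `Δτ` -/

/-- Shifting by one period does not change an image sum over `ℤ`: `Σ'_m p(β + s + mβ) = Σ'_m p(s + mβ)`. -/
theorem tsum_profile_add_period (p : ℝ → ℝ≥0∞) (β s : ℝ) : ∑' m : ℤ, p (β + s + m * β) = ∑' m : ℤ, p (s + m * β) := by
  rw [← (Equiv.addRight (1 : ℤ)).tsum_eq (fun m : ℤ => p (s + m * β))]
  refine tsum_congr fun m => ?_
  simp only [Equiv.coe_addRight]
  congr 1
  push_cast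
  ring

/-- **Off-site entry under a certified profile, EITHER sign of `Δτ`**: for grid points with `x₁ ≠ x₀`, `0 < β`, `1 ≤ M`, `N′ ≥ 4`, `L ≥ R + 1 + Σ_j|z_j|`,
and any `p : ℝ → ℝ≥0∞` with `p(t) ≥ ‖(1/2π)𝓕G(t/2π)‖₊` (`G = a¹_·(−z)` at `K = 0`, `Λ = klE0`):
`‖A((p₁,σ,+),(p₀,σ,−))‖₊ ≤ Σ'_m p(−Δτ + mβ) + ofReal(window tail + torus tail)` — the image-sum majorant is `β`-periodic, so the antiperiodic sign and the
case split disappear under the norm. -/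
theorem enorm_gridCov_offSite_le_tsum_profile {L M : ℕ} [NeZero L] {β : ℝ} (hβ : 0 < β) (hM : 0 < M) (μ : ℝ) {N : ℕ}
    {p₁ p₀ : GridPoint L N} (hx : p₁.2 ≠ p₀.2) (σ : Fin 2) {N' : ℕ} (hN' : 2 * 2 ≤ N')
    {R : ℕ} (hR : (R : ℤ) + 1 + ∑ j, |((p₁.2 j).val : ℤ) - (p₀.2 j).val| ≤ L) {p : ℝ → ℝ≥0∞}
    (hp : ∀ t : ℝ, (‖((1 / (2 * π) : ℝ) : ℂ) * 𝓕 (fun om : ℝ => mFourierCoeff (Torus.descend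
        (fun y : Momentum => uvSymbolFn 1 klE0 (frameLevel μ 0 ((2 * π) • y)) om) (uvSpatialSymbol_isLatticePeriodic 1 klE0 μ 0 om))
        (-(fun j => ((p₁.2 j).val : ℤ) - (p₀.2 j).val))) (t / (2 * π))‖₊ : ℝ≥0∞) ≤ p t) :
    (‖((hubbardGridSub L M β N).transpose * hubbardCovAboveCT L M β μ 0 0 klE0 * hubbardGridSub L M β N) ((p₁, σ), 0) ((p₀, σ), 1)‖₊ : ℝ≥0∞) ≤
      (∑' m : ℤ, p (-(gridTime β N p₁.1 - gridTime β N p₀.1) + m * β)) +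
        ENNReal.ofReal ((19 / 3) * (4 + |μ| + (0 : TrigPolyC4v).coeffNorm 0) * β / (2 * π ^ 2 * M) +
          (N' ! * klChi2CauchyTab N' * (N' + 1) ! * 4 * (max 1 (4 / klE0)) ^ (N' - 1) * ((2 * π) * 4) ^ N') * (2 / klE0) *
            (1 / (2 * Real.pi) ^ N' * (2 / ((2 * R + 2 : ℕ) : ℝ)) ^ (N' - 2 * 2) * (2 ^ 2 * ∑' k : Site 2, ∏ j, (1 + (k j : ℝ) ^ 2)⁻¹))) := by
  rcases le_total (gridTime β N p₁.1 - gridTime β N p₀.1) 0 with hle | hge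
  · exact enorm_gridCov_offSite_le_tsum_profile_of_nonpos hβ hM μ hx hle σ hN' hR hp
  · have h := enorm_gridCov_offSite_le_tsum_profile_of_nonneg hβ hM μ hx hge σ hN' hR hp
    rwa [show β - (gridTime β N p₁.1 - gridTime β N p₀.1) = β + -(gridTime β N p₁.1 - gridTime β N p₀.1) by ring,
      tsum_profile_add_period] at h


/-! ## §4 The profile reading with ANY representative of `x₁ − x₀` (the record indexes profiles by the CENTRED difference) -/

/-- **Off-site entry under a certified profile, any representative, either sign of `Δτ`**: for grid points with `x₁ ≠ x₀`, ANY `z : ℤ²` with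
`proj z = x₁ − x₀` (the centred one makes `R + 1 + Σ|z_j| ≤ L` usable), `0 < β`, `1 ≤ M`, `N′ ≥ 4`, and any `p : ℝ → ℝ≥0∞` with
`p(t) ≥ ‖(1/2π)𝓕G(t/2π)‖₊`, `G = a¹_·(−z)` at `K = 0`, `Λ = klE0`:
`‖A((p₁,σ,+),(p₀,σ,−))‖₊ ≤ Σ'_m p(−Δτ + mβ) + ofReal((19/3)(4+|μ|+‖0‖₀)β/(2π²M) + D₀(N′)(2/klE0)(2/(2R+2))^{N′−4}4C₂/(2π)^{N′})`. -/
theorem enorm_gridCov_offSite_le_tsum_profile_of_proj_eq {L M : ℕ} [NeZero L] {β : ℝ} (hβ : 0 < β) (hM : 0 < M) (μ : ℝ) {N : ℕ}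
    {p₁ p₀ : GridPoint L N} (hx : p₁.2 ≠ p₀.2) {z : Site 2} (hzx : Torus.proj L z = p₁.2 - p₀.2) (σ : Fin 2) {N' : ℕ} (hN' : 2 * 2 ≤ N')
    {R : ℕ} (hR : (R : ℤ) + 1 + ∑ j, |z j| ≤ L) {p : ℝ → ℝ≥0∞}
    (hp : ∀ t : ℝ, (‖((1 / (2 * π) : ℝ) : ℂ) * 𝓕 (fun om : ℝ => mFourierCoeff (Torus.descend
        (fun y : Momentum => uvSymbolFn 1 klE0 (frameLevel μ 0 ((2 * π) • y)) om) (uvSpatialSymbol_isLatticePeriodic 1 klE0 μ 0 om))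
        (-z)) (t / (2 * π))‖₊ : ℝ≥0∞) ≤ p t) :
    (‖((hubbardGridSub L M β N).transpose * hubbardCovAboveCT L M β μ 0 0 klE0 * hubbardGridSub L M β N) ((p₁, σ), 0) ((p₀, σ), 1)‖₊ : ℝ≥0∞) ≤
      (∑' m : ℤ, p (-(gridTime β N p₁.1 - gridTime β N p₀.1) + m * β)) +
        ENNReal.ofReal ((19 / 3) * (4 + |μ| + (0 : TrigPolyC4v).coeffNorm 0) * β / (2 * π ^ 2 * M) +
          (N' ! * klChi2CauchyTab N' * (N' + 1) ! * 4 * (max 1 (4 / klE0)) ^ (N' - 1) * ((2 * π) * 4) ^ N') * (2 / klE0) *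
            (1 / (2 * Real.pi) ^ N' * (2 / ((2 * R + 2 : ℕ) : ℝ)) ^ (N' - 2 * 2) * (2 ^ 2 * ∑' k : Site 2, ∏ j, (1 + (k j : ℝ) ^ 2)⁻¹))) := by
  have hE0 : (0 : ℝ) < klE0 := by norm_num [klE0]
  have hz : Torus.proj L z ≠ 0 := by rw [hzx]; exact sub_ne_zero.2 hx
  have hz' : -z ≠ 0 := by
    intro h0; apply hz; rw [neg_eq_zero.1 h0]; funext j; simp [Literature.Probability.LatticeModels.Torus.proj_apply]
  obtain ⟨hlo, hhi⟩ := gridTime_sub_mem hβ.le p₁.1 p₀.1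
  have hsum := fun (τ : ℝ) (h0 : 0 ≤ τ) (h1 : τ ≤ β) => latticeKernel_images_summable zero_le_one hE0 μ 0 (one_le_klChi2CauchyTab 2)
    (salmhoferCutoff_flat_cauchy_table_deriv 2)
    (fun q => Summit.HubbardSuperconductivity.HubbardSuperconductivity.Theorems.EngineV8.norm_iteratedFDeriv_frameLevel_zero_le μ le_rfl q) hz' hβ
    (τ := τ) h0 h1
  rcases le_total (gridTime β N p₁.1 - gridTime β N p₀.1) 0 with hle | hge
  · exact enorm_le_add_ofReal_of_norm_sub_le
      (Or.inl (norm_gridCov_offSite_sub_images_le_of_nonpos_of_proj_eq hβ hM μ hx hzx hle σ hN' hR))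
      (enorm_tsum_alternating_le_tsum_profile (hsum (-(gridTime β N p₁.1 - gridTime β N p₀.1)) (by linarith) (by linarith)) hp)
  · have h := enorm_le_add_ofReal_of_norm_sub_le
      (Or.inr (norm_gridCov_offSite_sub_neg_images_le_of_nonneg_of_proj_eq hβ hM μ hx hzx hge σ hN' hR))
      (enorm_tsum_alternating_le_tsum_profile (hsum (β - (gridTime β N p₁.1 - gridTime β N p₀.1)) (by linarith) (by linarith)) hp)
    rwa [show β - (gridTime β N p₁.1 - gridTime β N p₀.1) = β + -(gridTime β N p₁.1 - gridTime β N p₀.1) by ring,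
      tsum_profile_add_period] at h

end Summit.HubbardSuperconductivity.HubbardSuperconductivity.Theorems.KLRegimeSplit

end
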